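import Summits.Ventures.CertifiedQuantumChemistry.Rows.GapCertificateCodimOne
import Summits.Ventures.CertifiedQuantumChemistry.Rows.SingletRows
import HarnessLib

/-!
# Ventures/CertifiedQuantumChemistry — Rows/SingletGapCertificateCodimOne.lean: the gap certificate and
# its level-shift producer ON THE SINGLET SUBSPACE `K = (n, n)-sector ∩ ker Ŝ_+` (door M1, producer #2:
# the OPEN-SHELL-SINGLET deflator; HYPOTHESES-M1OS (G); the Temple row (T) is `Rows/SingletTempleRows.lean`)

HONEST FRAMING (verbatim): certified bounds for a stated model Hamiltonian in a stated basis; not a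
claim about the real molecule or material beyond that model.

Typer chem-type-09 (LADDER-CHEM I-TYPE slot 09, custody of `Rows/Temple*` / `Rows/GapCertificate*`;
chem-lead g6 2026-08-27T02:51:22Z «the K-version of `gapCertificateCodimOne_of_lowerRow_shift` stays
type-09's»), for chem-idea-1's `solver/gap-temple/HYPOTHESES-M1OS.md` v0.2 (a209b33e934651fa), consumed by
chem-type-02 (`Literature/…/SymmetricDeflation.lean`: the block-deflator discharge of the form bound (n2))
and chem-type-06 ((J′) `Rows/SingletGroundStateOverlapRows.lean`: Eckart on `K`).

WHY `K` AND NOT THE SECTOR (HYPOTHESES-M1OS «Objects»): for an open-shell singlet target (α1 HC / HFe2 :XS,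
`(a, b) = (8, 8)`) the second eigenvalue of `Ĥ(F)` on the PLAIN `(n, n)` sector is the `M = 0` component of
the lowest TRIPLET, `+0.4 mE_h` above `E₀` [float] — a gap no Temple quotient can use; and the deflator's
top label block meets the sector in a `(2S_A + 1)`-fold family but meets `K = sector ∩ ker Ŝ_+` (the
singlet subspace `singletSector k n` of `Statement.lean`, `F.singletEnergy n = min Ĥ(F)|K`) in ONE line
`ℂΦ`. So every object of `Rows/GapCertificateCodimOne.lean` is re-typed with the sector replaced by `K`;
the certified LOWER ROW of the shifted file stays an ORDINARY sector row (`LowerRow (Model.lincomb 1 λ F S)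
n n ℓ`, kind `DQG:flip` — any superset `W ⊇ K` will do, (n3)), or a singlet row (`:s2=0` leg).

## Contents (two `def`s — certificate SHAPES, nothing asserted; everything else PROVED, 0 sorry)
* §1 `SingletGapCertificate F n β` (spectral gap leg on `K`), `SingletGapCertificateCodimOne F n σ`
  («`λ₂(Ĥ_F | K) ≥ σ` counting multiplicity», the `(W, u)` input of `TempleKato.gap_of_codimOne_certificate`
  with `K = singletSector k n`); `mono`; a sector certificate IS a singlet one
  (`GapCertificateCodimOne.singlet`); DOWNGRADE `SingletGapCertificateCodimOne.singletGapCertificate`.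
* §2 THE POINTWISE CORE of (G), `K`-agnostic: `form_ge_of_lowerRow_shift` — `0 ≤ λ`, a sector lower row
  `ℓ ≤ E₀(Ĥ(F + λS); a, b)`, a sector vector `x` with `Re⟨x, Ĥ(S)x⟩ ≤ c‖x‖²` ⇒ `(ℓ − λc)‖x‖² ≤ Re⟨x, Ĥ(F)x⟩`;
  and `form_ge_of_singletLowerRow_shift` (the same from a SINGLET lower row of the shifted file, `x ∈ K`).
* §3 (G) in three currencies: `singlet_hgap_of_lowerRow_shift` (type-06's `hgap` VERBATIM:
  `∀ x ∈ singletSector k n, ⟨v, x⟩ = 0 → σ‖x‖² ≤ Re⟨x, Ĥ(F)x⟩`, `σ = ℓ − λc`),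
  `singletGapCertificateCodimOne_of_forall_orthogonal` (producer-agnostic: `hgap` ⇒ certificate) and
  `singletGapCertificateCodimOne_of_lowerRow_shift` / `…_of_singletLowerRow_shift` (THE (G) LEMMA), each
  with the two-predicate spelling (`IsInSector n n x → spinPlus *ᵥ x = 0 → …`) as primary `hSform` and the
  submodule spelling as a `'` variant.
* (T) TEMPLE ON `K` — `SingletTempleCertificate`, `singletLowerRow_of_temple`, the singlet bracket from
  one exact singlet witness and the end-to-end (n1)+(n2)+(n3)+(T) statement: `Rows/SingletTempleRows.lean`.
What is NOT here: the deflator files `S` (G_θ weight FCIDUMP, chem-idea-1; sub-Hamiltonian X, chem-idea-2),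
the block check discharging (n2) (chem-type-02), Eckart / overlap rows on `K` (chem-type-06), any number.
References as in the sector file: Horn–Johnson (2013) Thm 4.2.6 (Courant–Fischer two-dimensional step)
[cite: HornJohnson2013, Thm 4.2.6]; Reed–Simon IV Thm XIII.5 (Temple) [cite: ReedSimonIV1978, Thm XIII.5].
-/

noncomputable section

namespace Summit.Ventures.CertifiedQuantumChemistry

open Matrix Finset
open Literature.MathematicalPhysics.QuantumLattice Literature.MathematicalPhysics.QuantumChemistry
open Literature.MathematicalPhysics.QuantumLattice.EigenvalueContinuation
open scoped ComplexOrder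

variable {k : ℕ}

/-! ## §0 The singlet subspace: membership and invariance -/

/-- Membership in `K = singletSector k n` in the cell's two-predicate currency: `x` lies in the `(n, n)`
determinant sector and `Ŝ_+ x = 0`. -/
theorem mem_singletSector_iff_isInSector {n : ℕ} (x : Fock (Orb (Fin k))) :
    x ∈ singletSector k n ↔ IsInSector n n x ∧ spinPlus *ᵥ x = 0 := by
  rw [mem_singletSector_iff, mem_szSector_iff_isInSector]

/-- `K` is invariant under `Ĥ(F)` (the spin-free Hamiltonian commutes with `N̂`, `Ŝ_z`, `Ŝ_+`;
`Rows/SingletRows.mulVec_mem_szSector_inf_ker_spinPlus`). -/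
theorem Model.hamiltonian_mulVec_mem_singletSector (F : Model k) {n : ℕ} {x : Fock (Orb (Fin k))}
    (hx : x ∈ singletSector k n) : F.hamiltonian *ᵥ x ∈ singletSector k n :=
  mulVec_mem_szSector_inf_ker_spinPlus (molecularHamiltonian_commute_totalNumber _ _ _)
    (molecularHamiltonian_commute_spinZ _ _ _) (molecularHamiltonian_commute_spinPlus _ _ _) hx

/-- `K ≠ ⊥` on the physical range `n ≤ k`. -/
theorem singletSector_ne_bot {n : ℕ} (hn : n ≤ k) : singletSector k n ≠ ⊥ :=
  szSector_inf_ker_spinPlus_ne_bot (by simpa using hn)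

/-- The singlet energy is the minimum of `Ĥ(F)` on `K` (definitional). -/
theorem Model.singletEnergy_eq_minEnergyOn (F : Model k) (n : ℕ) :
    F.singletEnergy n = F.hamiltonian.minEnergyOn (singletSector k n) := rfl

/-! ## §1 The certificate shapes on `K` -/

/-- **SPECTRAL GAP LEG ON `K`** at level `β`: every eigenvalue `e` of `Ĥ(F)` carried by a NONZERO vector
of the singlet subspace `K = singletSector k n`, other than the singlet ground energy
`E₀(Ĥ_F; N = 2n, S = 0) = F.singletEnergy n`, satisfies `β ≤ e` — the `K`-twin of solver-6's
`GapCertificate` (`Rows/TempleLowerRow.lean`) and exactly the gap hypothesis of Temple's inequality on `K`.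
A degenerate singlet ground level is allowed. [cite: ReedSimonIV1978, Thm XIII.5] -/
def SingletGapCertificate (F : Model k) (n : ℕ) (β : ℚ) : Prop :=
  ∀ (e : ℝ) (v : Fock (Orb (Fin k))), v ∈ singletSector k n → v ≠ 0 →
    F.hamiltonian *ᵥ v = (e : ℂ) • v → e ≠ F.singletEnergy n → ((β : ℚ) : ℝ) ≤ e

/-- **CODIMENSION-ONE GAP CERTIFICATE ON `K`** at level `σ` (HYPOTHESES-M1OS (G)): there are a subspace
`W` of the Fock space and a vector `u` with the form of `Ĥ(F)` `≥ σ‖·‖²` on `W` and every vector of the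
singlet subspace `K = singletSector k n` of the form `z + c•u`, `z ∈ W` — «`λ₂(Ĥ_F | K) ≥ σ` COUNTING
MULTIPLICITY» by the two-dimensional Courant–Fischer step (`TempleKato.gap_of_codimOne_certificate` with
`K = singletSector k n`). The `K`-twin of `GapCertificateCodimOne`. [cite: HornJohnson2013, Thm 4.2.6] -/
def SingletGapCertificateCodimOne (F : Model k) (n : ℕ) (σ : ℚ) : Prop :=
  ∃ (W : Submodule ℂ (Fock (Orb (Fin k)))) (u : Fock (Orb (Fin k))),
    (∀ z ∈ W, ((σ : ℚ) : ℝ) * (star z ⬝ᵥ z).re ≤ (star z ⬝ᵥ F.hamiltonian *ᵥ z).re) ∧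
      ∀ x ∈ singletSector k n, ∃ z ∈ W, ∃ c : ℂ, x = z + c • u

/-- A codimension-one certificate on `K` may be weakened downwards in `σ`. -/
theorem SingletGapCertificateCodimOne.mono {F : Model k} {n : ℕ} {σ σ' : ℚ}
    (h : SingletGapCertificateCodimOne F n σ) (hle : σ' ≤ σ) : SingletGapCertificateCodimOne F n σ' := by
  obtain ⟨W, u, hW, hWK⟩ := h
  refine ⟨W, u, fun z hz => le_trans ?_ (hW z hz), hWK⟩
  exact mul_le_mul_of_nonneg_right (by exact_mod_cast hle) (re_star_dotProduct_self_nonneg z)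

/-- A spectral gap leg on `K` may be weakened downwards in `β`. -/
theorem SingletGapCertificate.mono {F : Model k} {n : ℕ} {β β' : ℚ} (h : SingletGapCertificate F n β)
    (hle : β' ≤ β) : SingletGapCertificate F n β' := fun e v hv hv0 hHv hne =>
  le_trans (by exact_mod_cast hle) (h e v hv hv0 hHv hne)

/-- **A SECTOR certificate is a singlet certificate** (`K ⊆ sector`; same `W`, same `u`). Useful only when
the sector itself is gapped above `E₀` at `σ` — NOT the open-shell-singlet situation, recorded for
completeness. -/
theorem GapCertificateCodimOne.singlet {F : Model k} {n : ℕ} {σ : ℚ} (h : GapCertificateCodimOne F n n σ) :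
    SingletGapCertificateCodimOne F n σ := by
  obtain ⟨W, u, hW, hWK⟩ := h
  exact ⟨W, u, hW, fun x hx => hWK x ((mem_singletSector_iff_isInSector x).1 hx).1⟩

/-- **DOWNGRADE to the spectral gap leg on `K`.** `SingletGapCertificateCodimOne F n σ` (symmetric `F`)
implies `SingletGapCertificate F n σ`: an eigenvector in `K` at an eigenvalue `e ≠ E₀^K` is orthogonal to
a ground eigenvector of `Ĥ(F)|K`, and on that hyperplane of `K` the certified form is `≥ σ`
(`TempleKato.gap_of_codimOne_certificate`) when `E₀^K < σ`; when `σ ≤ E₀^K` every eigenvalue on `K` is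
`≥ E₀^K ≥ σ` (variational principle on `K`). [cite: HornJohnson2013, Thm 4.2.6] -/
theorem SingletGapCertificateCodimOne.singletGapCertificate {F : Model k} (hF : F.IsSymmetric) {n : ℕ}
    {σ : ℚ} (hG : SingletGapCertificateCodimOne F n σ) : SingletGapCertificate F n σ := by
  intro e v hvK hv0 hHv hne
  obtain ⟨W, u, hW, hWK⟩ := hG
  have hH : F.hamiltonian.IsHermitian := Model.hamiltonian_isHermitian hF
  set K : Submodule ℂ (Fock (Orb (Fin k))) := singletSector k n with hKdef
  have hE : F.singletEnergy n = F.hamiltonian.minEnergyOn K := rfl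
  have hvpos : 0 < (star v ⬝ᵥ v).re := re_star_dotProduct_self_pos hv0
  have hev : (star v ⬝ᵥ F.hamiltonian *ᵥ v).re = e * (star v ⬝ᵥ v).re :=
    re_star_dotProduct_mulVec_of_eigen hHv
  by_cases hσ : F.singletEnergy n < ((σ : ℚ) : ℝ)
  · have hKH : ∀ x ∈ K, F.hamiltonian *ᵥ x ∈ K := fun x hx => F.hamiltonian_mulVec_mem_singletSector hx
    have hKne : K ≠ ⊥ := fun h => hv0 ((Submodule.mem_bot ℂ).1 (h ▸ hvK))
    obtain ⟨ψ, hψK, hψ1, hHψ⟩ := exists_unit_eigen_minEnergyOn hH K hKH hKne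
    rw [← hE] at hHψ
    have horth : star ψ ⬝ᵥ v = 0 :=
      star_dotProduct_eq_zero_of_eigen hH.eq (Ne.symm hne) hHψ hHv
    have hgap := TempleKato.gap_of_codimOne_certificate hH.eq hW hWK hψK hψ1 hHψ hσ hvK horth
    rw [hev] at hgap
    exact le_of_mul_le_mul_right hgap hvpos
  · push Not at hσ
    have hE0 : F.singletEnergy n * (star v ⬝ᵥ v).re ≤ (star v ⬝ᵥ F.hamiltonian *ᵥ v).re := by
      rw [hE]
      exact minEnergyOn_mul_le_re_rayleigh hH K hvK
    rw [hev] at hE0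
    exact hσ.trans (le_of_mul_le_mul_right hE0 hvpos)

/-! ## §2 The pointwise core of the level-shift producer (`K`-agnostic) -/

/-- The Rayleigh quotient of the shifted file `Ĥ(F + λ·S) = Ĥ(F) + λ·Ĥ(S)` (`Model.hamiltonian_lincomb`).
[folklore] -/
private theorem re_rayleigh_lincomb_one' (lam : ℚ) (F S : Model k) (x : Fock (Orb (Fin k))) :
    (star x ⬝ᵥ (Model.lincomb 1 lam F S).hamiltonian *ᵥ x).re =
      (star x ⬝ᵥ F.hamiltonian *ᵥ x).re + (lam : ℝ) * (star x ⬝ᵥ S.hamiltonian *ᵥ x).re := by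
  rw [Model.re_rayleigh_lincomb, Rat.cast_one, one_mul]

/-- **THE POINTWISE CORE OF THE LEVEL-SHIFT DEFLATION** (the algebra of HYPOTHESES-M1OS (G), stated once
for any vector): for symmetric `F`, `S`, `0 ≤ λ`, an ORDINARY certified lower row `ℓ ≤ E₀(Ĥ(F + λS); a, b)`
of the exact combined file `Model.lincomb 1 λ F S`, and a vector `x` OF THE `(a, b)` SECTOR at which the
deflator form is small, `Re⟨x, Ĥ(S)x⟩ ≤ c‖x‖²`: then `(ℓ − λc)‖x‖² ≤ Re⟨x, Ĥ(F)x⟩`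
(`ℓ‖x‖² ≤ Re⟨x, Ĥ(F + λS)x⟩ = Re⟨x, Ĥ(F)x⟩ + λRe⟨x, Ĥ(S)x⟩ ≤ Re⟨x, Ĥ(F)x⟩ + λc‖x‖²`). Whatever subspace
the deflator analysis lives on (`K`, a symmetry block, …) only has to supply the premise at its vectors.
[cite: HornJohnson2013, Thm 4.2.6] -/
theorem form_ge_of_lowerRow_shift {F S : Model k} (hF : F.IsSymmetric) (hS : S.IsSymmetric) {a b : ℕ}
    {lam : ℚ} (hlam : 0 ≤ lam) {c ℓ : ℚ} (hL : LowerRow (Model.lincomb 1 lam F S) a b ℓ)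
    {x : Fock (Orb (Fin k))} (hx : IsInSector a b x)
    (hSx : (star x ⬝ᵥ S.hamiltonian *ᵥ x).re ≤ ((c : ℚ) : ℝ) * (star x ⬝ᵥ x).re) :
    (((ℓ - lam * c : ℚ) : ℚ) : ℝ) * (star x ⬝ᵥ x).re ≤ (star x ⬝ᵥ F.hamiltonian *ᵥ x).re := by
  have hx' : x ∈ szSector (a + b) (((a : ℝ) - b) / 2) := (mem_szSector_iff_isInSector a b x).2 hx
  have hvar := minEnergyOn_mul_le_re_rayleigh
    (Model.hamiltonian_isHermitian (Model.lincomb_isSymmetric (α := 1) (β := lam) hF hS)) _ hx'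
  have hℓ := hL.le
  have hn : 0 ≤ (star x ⬝ᵥ x).re := re_star_dotProduct_self_nonneg x
  have h1 : ((ℓ : ℚ) : ℝ) * (star x ⬝ᵥ x).re ≤
      (star x ⬝ᵥ (Model.lincomb 1 lam F S).hamiltonian *ᵥ x).re :=
    le_trans (mul_le_mul_of_nonneg_right hℓ hn) hvar
  rw [re_rayleigh_lincomb_one'] at h1
  have h2 := mul_le_mul_of_nonneg_left hSx (show (0 : ℝ) ≤ lam by exact_mod_cast hlam)
  push_cast
  nlinarith

/-- **The same from a SINGLET lower row of the shifted file** (the `:s2=0` leg kind, HYPOTHESES-M1OS (n3)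
`W = sector ∩ {tr Ŝ²Γ = 0}`): `ℓ ≤ E₀^{S=0}(Ĥ(F + λS); n)` and `x ∈ K` with `Re⟨x, Ĥ(S)x⟩ ≤ c‖x‖²` give
`(ℓ − λc)‖x‖² ≤ Re⟨x, Ĥ(F)x⟩`. [cite: HornJohnson2013, Thm 4.2.6] -/
theorem form_ge_of_singletLowerRow_shift {F S : Model k} (hF : F.IsSymmetric) (hS : S.IsSymmetric)
    {n : ℕ} {lam : ℚ} (hlam : 0 ≤ lam) {c ℓ : ℚ} (hL : SingletLowerRow (Model.lincomb 1 lam F S) n ℓ)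
    {x : Fock (Orb (Fin k))} (hx : x ∈ singletSector k n)
    (hSx : (star x ⬝ᵥ S.hamiltonian *ᵥ x).re ≤ ((c : ℚ) : ℝ) * (star x ⬝ᵥ x).re) :
    (((ℓ - lam * c : ℚ) : ℚ) : ℝ) * (star x ⬝ᵥ x).re ≤ (star x ⬝ᵥ F.hamiltonian *ᵥ x).re := by
  have hvar := minEnergyOn_mul_le_re_rayleigh
    (Model.hamiltonian_isHermitian (Model.lincomb_isSymmetric (α := 1) (β := lam) hF hS))
    (singletSector k n) hx
  have hℓ := hL.le
  rw [Model.singletEnergy_eq_minEnergyOn] at hℓ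
  have hn : 0 ≤ (star x ⬝ᵥ x).re := re_star_dotProduct_self_nonneg x
  have h1 : ((ℓ : ℚ) : ℝ) * (star x ⬝ᵥ x).re ≤
      (star x ⬝ᵥ (Model.lincomb 1 lam F S).hamiltonian *ᵥ x).re :=
    le_trans (mul_le_mul_of_nonneg_right hℓ hn) hvar
  rw [re_rayleigh_lincomb_one'] at h1
  have h2 := mul_le_mul_of_nonneg_left hSx (show (0 : ℝ) ≤ lam by exact_mod_cast hlam)
  push_cast
  nlinarith

/-! ## §3 (G): the gap certificate on `K`, in three currencies -/

/-- **PRODUCER-AGNOSTIC: from a form bound on `K` orthogonal to ONE explicit vector** (chem-type-06's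
(J′) `hgap` verbatim): if for some explicit `v` (the top coupling `Φ`, or any vector) every `x ∈ K` with
`⟨v, x⟩ = 0` has `σ‖x‖² ≤ Re⟨x, Ĥ(F)x⟩`, then `SingletGapCertificateCodimOne F n σ`
(`W = K ∩ v^⊥`, `u` from `TempleKato.exists_codimOne_of_vector_certificate` with `K = singletSector k n`).
[cite: HornJohnson2013, Thm 4.2.6] -/
theorem singletGapCertificateCodimOne_of_forall_orthogonal' (F : Model k) {n : ℕ} {σ : ℚ}
    (v : Fock (Orb (Fin k)))
    (hgap : ∀ x ∈ singletSector k n, star v ⬝ᵥ x = 0 →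
      ((σ : ℚ) : ℝ) * (star x ⬝ᵥ x).re ≤ (star x ⬝ᵥ F.hamiltonian *ᵥ x).re) :
    SingletGapCertificateCodimOne F n σ := by
  obtain ⟨W, u, hW, hWK⟩ := TempleKato.exists_codimOne_of_vector_certificate
    (A := F.hamiltonian) (singletSector k n) v hgap
  exact ⟨W, u, hW, hWK⟩

/-- The same with the orthogonal form bound in the two-predicate currency
(`IsInSector n n x → spinPlus *ᵥ x = 0 → …`). [cite: HornJohnson2013, Thm 4.2.6] -/
theorem singletGapCertificateCodimOne_of_forall_orthogonal (F : Model k) {n : ℕ} {σ : ℚ}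
    (v : Fock (Orb (Fin k)))
    (hgap : ∀ x : Fock (Orb (Fin k)), IsInSector n n x → spinPlus *ᵥ x = 0 → star v ⬝ᵥ x = 0 →
      ((σ : ℚ) : ℝ) * (star x ⬝ᵥ x).re ≤ (star x ⬝ᵥ F.hamiltonian *ᵥ x).re) :
    SingletGapCertificateCodimOne F n σ :=
  singletGapCertificateCodimOne_of_forall_orthogonal' F v fun x hx hvx =>
    hgap x ((mem_singletSector_iff_isInSector x).1 hx).1 ((mem_singletSector_iff_isInSector x).1 hx).2 hvx

/-- **(G) IN `hgap` CURRENCY** (the input of chem-type-06's (J′) Eckart-on-`K` rows and of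
`TempleKato.kato_temple_lower`, verbatim): symmetric `F`, `S`; `0 ≤ λ`; the deflator form bound on the
complement of `v` INSIDE `K` — `hSform : ∀ x, IsInSector n n x → Ŝ_+x = 0 → ⟨v, x⟩ = 0 →
Re⟨x, Ĥ(S)x⟩ ≤ c‖x‖²` (HYPOTHESES-M1OS (n2), discharged by chem-type-02's block check); an ORDINARY sector
lower row `ℓ ≤ E₀(Ĥ(F + λS); n, n)` of the exact combined file (n3) ⇒ for every `x ∈ singletSector k n`
with `⟨v, x⟩ = 0`: `(ℓ − λc)‖x‖² ≤ Re⟨x, Ĥ(F)x⟩`. [cite: HornJohnson2013, Thm 4.2.6] -/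
theorem singlet_hgap_of_lowerRow_shift {F S : Model k} (hF : F.IsSymmetric) (hS : S.IsSymmetric)
    {n : ℕ} {lam : ℚ} (hlam : 0 ≤ lam) (v : Fock (Orb (Fin k))) {c : ℚ}
    (hSform : ∀ x : Fock (Orb (Fin k)), IsInSector n n x → spinPlus *ᵥ x = 0 → star v ⬝ᵥ x = 0 →
      (star x ⬝ᵥ S.hamiltonian *ᵥ x).re ≤ ((c : ℚ) : ℝ) * (star x ⬝ᵥ x).re)
    {ℓ : ℚ} (hL : LowerRow (Model.lincomb 1 lam F S) n n ℓ) :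
    ∀ x ∈ singletSector k n, star v ⬝ᵥ x = 0 →
      (((ℓ - lam * c : ℚ) : ℚ) : ℝ) * (star x ⬝ᵥ x).re ≤ (star x ⬝ᵥ F.hamiltonian *ᵥ x).re :=
  fun x hx hvx =>
    form_ge_of_lowerRow_shift hF hS hlam hL ((mem_singletSector_iff_isInSector x).1 hx).1
      (hSform x ((mem_singletSector_iff_isInSector x).1 hx).1 ((mem_singletSector_iff_isInSector x).1 hx).2
        hvx)

/-- **(G): THE LEVEL-SHIFT DEFLATION PRODUCER ON `K`** (HYPOTHESES-M1OS (G); the `K`-version of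
`gapCertificateCodimOne_of_lowerRow_shift`, chem-lead g6 2026-08-27T02:51:22Z). Symmetric `F`, `S`, `0 ≤ λ`,
`hSform` on `K ∩ v^⊥` as above, and an ORDINARY certified lower row `ℓ ≤ E₀(Ĥ(F + λS); n, n)` of the exact
combined file `Model.lincomb 1 λ F S` (FORMAT-qcl1, readers A∧B; a `DQG:flip` leg is this kind) give
`SingletGapCertificateCodimOne F n (ℓ − λc)`: «`λ₂(Ĥ_F | K) ≥ ℓ − λc`». For the block deflator
`S = G_θ − c` is absorbed by taking `c` here; `v = Φ` the top singlet coupling. [cite: HornJohnson2013, Thm 4.2.6] -/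
theorem singletGapCertificateCodimOne_of_lowerRow_shift {F S : Model k} (hF : F.IsSymmetric)
    (hS : S.IsSymmetric) {n : ℕ} {lam : ℚ} (hlam : 0 ≤ lam) (v : Fock (Orb (Fin k))) {c : ℚ}
    (hSform : ∀ x : Fock (Orb (Fin k)), IsInSector n n x → spinPlus *ᵥ x = 0 → star v ⬝ᵥ x = 0 →
      (star x ⬝ᵥ S.hamiltonian *ᵥ x).re ≤ ((c : ℚ) : ℝ) * (star x ⬝ᵥ x).re)
    {ℓ : ℚ} (hL : LowerRow (Model.lincomb 1 lam F S) n n ℓ) :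
    SingletGapCertificateCodimOne F n (ℓ - lam * c) :=
  singletGapCertificateCodimOne_of_forall_orthogonal' F v (singlet_hgap_of_lowerRow_shift hF hS hlam v hSform hL)

/-- (G), submodule spelling of `hSform` (`∀ x ∈ singletSector k n, ⟨v, x⟩ = 0 → …`).
[cite: HornJohnson2013, Thm 4.2.6] -/
theorem singletGapCertificateCodimOne_of_lowerRow_shift' {F S : Model k} (hF : F.IsSymmetric)
    (hS : S.IsSymmetric) {n : ℕ} {lam : ℚ} (hlam : 0 ≤ lam) (v : Fock (Orb (Fin k))) {c : ℚ}
    (hSform : ∀ x ∈ singletSector k n, star v ⬝ᵥ x = 0 →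
      (star x ⬝ᵥ S.hamiltonian *ᵥ x).re ≤ ((c : ℚ) : ℝ) * (star x ⬝ᵥ x).re)
    {ℓ : ℚ} (hL : LowerRow (Model.lincomb 1 lam F S) n n ℓ) :
    SingletGapCertificateCodimOne F n (ℓ - lam * c) :=
  singletGapCertificateCodimOne_of_lowerRow_shift hF hS hlam v
    (fun x hx hP hvx => hSform x ((mem_singletSector_iff_isInSector x).2 ⟨hx, hP⟩) hvx) hL

/-- **(G) from a SINGLET lower row of the shifted file** (the `:s2=0` leg kind): `hSform` on `K ∩ v^⊥` and
`SingletLowerRow (Model.lincomb 1 λ F S) n ℓ` give `SingletGapCertificateCodimOne F n (ℓ − λc)`.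
[cite: HornJohnson2013, Thm 4.2.6] -/
theorem singletGapCertificateCodimOne_of_singletLowerRow_shift {F S : Model k} (hF : F.IsSymmetric)
    (hS : S.IsSymmetric) {n : ℕ} {lam : ℚ} (hlam : 0 ≤ lam) (v : Fock (Orb (Fin k))) {c : ℚ}
    (hSform : ∀ x : Fock (Orb (Fin k)), IsInSector n n x → spinPlus *ᵥ x = 0 → star v ⬝ᵥ x = 0 →
      (star x ⬝ᵥ S.hamiltonian *ᵥ x).re ≤ ((c : ℚ) : ℝ) * (star x ⬝ᵥ x).re)
    {ℓ : ℚ} (hL : SingletLowerRow (Model.lincomb 1 lam F S) n ℓ) :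
    SingletGapCertificateCodimOne F n (ℓ - lam * c) :=
  singletGapCertificateCodimOne_of_forall_orthogonal' F v fun x hx hvx =>
    form_ge_of_singletLowerRow_shift hF hS hlam hL hx
      (hSform x ((mem_singletSector_iff_isInSector x).1 hx).1 ((mem_singletSector_iff_isInSector x).1 hx).2
        hvx)

/-- A sector lower row of the shifted file is the weaker premise: it implies the singlet lower row
(`LowerRow.singlet`), so the two producers agree — recorded as the bridge between (n3)'s leg kinds. -/
theorem singletGapCertificateCodimOne_of_lowerRow_shift_eq_of_singlet {F S : Model k}
    (hF : F.IsSymmetric) (hS : S.IsSymmetric) {n : ℕ} {lam : ℚ} (hlam : 0 ≤ lam)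
    (v : Fock (Orb (Fin k))) {c : ℚ}
    (hSform : ∀ x : Fock (Orb (Fin k)), IsInSector n n x → spinPlus *ᵥ x = 0 → star v ⬝ᵥ x = 0 →
      (star x ⬝ᵥ S.hamiltonian *ᵥ x).re ≤ ((c : ℚ) : ℝ) * (star x ⬝ᵥ x).re)
    {ℓ : ℚ} (hL : LowerRow (Model.lincomb 1 lam F S) n n ℓ) :
    SingletGapCertificateCodimOne F n (ℓ - lam * c) :=
  singletGapCertificateCodimOne_of_singletLowerRow_shift hF hS hlam v hSform
    (hL.singlet (Model.lincomb_isSymmetric (α := 1) (β := lam) hF hS))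

end Summit.Ventures.CertifiedQuantumChemistry

end
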